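import Summits.Ventures.GridStability.Lyapunov.NE39LossySplitLinesRecDualTests
import Summits.Ventures.GridStability.Lyapunov.NE39LossySplitLinesU3o200LPCert
import Literature.MathematicalPhysics.PowerSystems.LuriePostnikovSlabDualWitness
import HarnessLib

/-!
# «NE39-LOSSY-SPLITU-RECORD-CEILING» — the CLASS OF RECORD on the UNORDERED-LINES split presentation of the lossy 39-bus
# 10-machine Kron model is EMPTY from `2·arctan(3/200)` (≈ 1.719°) on — a RANK-19 GRAM-FACTORED dual witness —
# hence THE POSITIVITY LEVER MOVES THE 39-BUS SPLIT WINDOW (the positivity class is NON-EMPTY at 2·arctan(3/200) ≈ 1.719°)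

**OBSTRUCTION row beside «NE39-LOSSY-SPLITU» (second window) — class of record only.**  For `S = NE39.splitLurieLinesSystem`
(MODEL M = `NE39.preLossless.toModelRel (1/10) 0`; Pai's split presentation (3.43), `Models/NE39SplitLurieLines.lean`) and the window
`γ₀ = 2·arctan(3/200)` (≈ 1.719°):

* `D : SlabDualWitness NE39.splitLurieLinesSystem a0 b0` — lit-6's CLASS-OF-RECORD dual witness (`Z ⪰ 0`, (D1) EXACT, (D2), (D3) `s_k ≥ 0` where
  `a0_k ≥ 0`, (D4)), shipped as its rank-19 GRAM FACTOR `Z := [G1; H]·[G1; H]ᵀ` (data file A), positive semidefinite by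
  `Matrix.posSemidef_self_mul_conjTranspose` (`psd`) — the same device as the positivity-class witness `NE39LossySplitLinesLPDual`
  (C·B = 0 ⇒ no functional reads `Z₂₂` off its diagonal; `Z₂₂ := H·Hᵀ`); the blocks the functionals read are the kernel-decided
  tables (`Z11Q_gramᵣ`, `Z21Q_gramᵣ`);
* `no_splitSlabCertificate_at` — **no** `Λ : SlabCertificate S` (`P ⪰ ε·1`, Popov terms only on channels with `a ≥ 0`) satisfies
  the sector hypothesis of lit-6's slab ROA theorem for the window `γ₀`; `no_splitSlabCertificate_perChannel`; the set form for every
  window `≥ γ₀ = 2·arctan(3/200)` is the second conjunct of `positivityLever_split_NE39` (the generic corollaries «no certificate at any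
  `γ ≥ γ₀`» are not restated: they read verbatim like `NE39LossySplitLinesLPDual.no_splitSlabCertificate_NE39 / splitSlabClass_empty_NE39`);
* `γ₀_le_γ3_200` and **`positivityLever_split_NE39`** — at `2·arctan(3/200)` (≈ 1.719°, `≥ γ₀`) the POSITIVITY class is NON-EMPTY
  (`NE39LossySplitLinesU3o200LPCert.lpSplitClass_nonempty_NE39`, exact Schur-form certificate, p597195) while the CLASS OF RECORD is
  EMPTY there and above: on the 39-bus split object the Lur'e–Postnikov positivity lever MOVES the certifiable window (9-bus: ★ #134;
  two-area: it does not, ★ #157);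
* `γ₀_eq`, `γ₀_le` (and `NE39LossySplitLinesU3o200LPCert.cos_sin_γL`) — the window in closed form.

Producer (not trusted; every acceptance inequality is re-decided over `ℚ` in the kernel, files `…RecDualKernel` /
`…RecDualTests`): lit-6 g10 kit j297445 (`probes/splitgen/splitu_generic.py` JOB_SYSTEM=NE39 JOB_MODE=dualgram JOB_ACT=pairs JOB_CLASSES=old, class `old` (the class of record);
output `splitu_NE39_dualgram_lam1o10_pairs.json` sha16 `c103393dae5f31e7`, results[u0 = 3/200, klass = old]): max-margin CLASS-OF-RECORD dual SDP in floats (CLARABEL,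
`N = 19 + 180`, margin `μ* ≈ 6.67e-10`), then the GRAM FACTORISATION `G1 = chol(Z₁₁)` (19 × 19 lower), `H = Z₂₁·G1⁻ᵀ` (180 × 19),
dyadic rounding `2^-28`, and `Z := [G1; H]·[G1; H]ᵀ` EXACTLY — rank 19, positive semidefinite BY CONSTRUCTION (no 219 × 219
decision anywhere); since `C·B = 0` no dual functional reads `Z₂₂` off its diagonal, and the diagonal `|H_k|²` is the smallest
admissible one.  Exact re-check (`gen_ne39_recdual.py`): `W + Wᵀ` min pivot `1.76e-07`, min (D2) `2.25e-10`, min (D3) `s_k` (a0 ≥ 0)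
`2.99e-08`, `tr Z₁₁ = 1`.
THREE COLUMNS.  CERTIFIED: «no certificate of the class of record (`SlabCertificate S` + `hsec`) certifies a slab half-width
`≥ 2·arctan(3/200)` (≈ 1.719°) on model-4's lossy 39-bus model, while the positivity class is NON-EMPTY at 2·arctan(3/200) ≈
1.719° `≥ γ₀`».  VALIDATED (floats, lit-6 kit j292614 / j293727 / j297445): class of record primal margin `ν* > 0` at `u = 1/100`
(an exact class-of-record certificate at 1/100 sits untyped in json 8848e3991dd2e7c0), `< 0` at `3/200`; positivity class `ν* > 0` up
to `3/200`, dual-feasible from `13/800`.  MODELLED: as «NE39-LOSSY-SPLITU» / model-4's record.  The sentence is about CERTIFICATE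
CLASSES, not about the region of attraction of M or of any grid.
[cite: BoydVandenberghe2004, §5.9.4 (5.97)–(5.98), Example 5.14; Khalil2002, §7.1 Example 7.5, §7.1.2 Theorem 7.3; Pai1981, §3.6.3 (3.43)–(3.45), §4.6 p. 117; HornJohnson2013, Thm 7.2.7]
-/

noncomputable section

open Real Matrix
open Literature.Computation.Certificates
open Literature.MathematicalPhysics.PowerSystems
open Literature.MathematicalPhysics.PowerSystems.LyapunovFunctionFamily
open Summit.Ventures.GridStability.Models
open Summit.Ventures.GridStability.Lyapunov.NE39LossySplitLines (e1 AQ CQ BLQ A_eq C_eq B_eq C_mul_B)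

namespace Summit.Ventures.GridStability.Lyapunov.NE39LossySplitLinesRecDual

/-! ### Cast plumbing (the parent files' copies are private) -/

/-- `(M + N) ↦ ℝ` (cast plumbing). -/ private theorem map_add' {m n : Type*} (M N : Matrix m n ℚ) :
    (M + N).map (Rat.cast : ℚ → ℝ) = M.map (Rat.cast : ℚ → ℝ) + N.map (Rat.cast : ℚ → ℝ) := by
  ext i k; simp
/-- `(M − N) ↦ ℝ` (cast plumbing). -/ private theorem map_sub' {m n : Type*} (M N : Matrix m n ℚ) :
    (M - N).map (Rat.cast : ℚ → ℝ) = M.map (Rat.cast : ℚ → ℝ) - N.map (Rat.cast : ℚ → ℝ) := by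
  ext i k; simp
/-- `(q • M) ↦ ℝ` (cast plumbing). -/ private theorem map_smul' {m n : Type*} (q : ℚ) (M : Matrix m n ℚ) :
    (q • M).map (Rat.cast : ℚ → ℝ) = ((q : ℚ) : ℝ) • M.map (Rat.cast : ℚ → ℝ) := by
  ext i k; simp
/-- `(M N) ↦ ℝ` (cast plumbing). -/ private theorem map_mul' {l m n : Type*} [Fintype m] (M : Matrix l m ℚ) (N : Matrix m n ℚ) :
    (M * N).map (Rat.cast : ℚ → ℝ) = M.map (Rat.cast : ℚ → ℝ) * N.map (Rat.cast : ℚ → ℝ) := by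
  ext i k; simp [Matrix.mul_apply]
/-- `Mᵀ ↦ ℝ` (cast plumbing). -/ private theorem map_transpose' {m n : Type*} (M : Matrix m n ℚ) :
    Mᵀ.map (Rat.cast : ℚ → ℝ) = (M.map (Rat.cast : ℚ → ℝ))ᵀ := by
  ext i k; simp

/-! ### The witness data over `ℝ` -/

/-- `Z₁₁ ↦ ℝ`. -/
def Z₁₁ : Matrix (Fin 10 ⊕ Fin 9) (Fin 10 ⊕ Fin 9) ℝ := Z11Qᵣ.map (Rat.cast : ℚ → ℝ)
/-- `Z₂₁ ↦ ℝ`. -/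
def Z₂₁ : Matrix ((Fin 10 × Fin 10) ⊕ (Fin 10 × Fin 10)) (Fin 10 ⊕ Fin 9) ℝ := Z21Qᵣ.map (Rat.cast : ℚ → ℝ)
/-- `Z₂₂ = H·Hᵀ ↦ ℝ`. -/
def Z₂₂ : Matrix ((Fin 10 × Fin 10) ⊕ (Fin 10 × Fin 10)) ((Fin 10 × Fin 10) ⊕ (Fin 10 × Fin 10)) ℝ := Z22Qᵣ.map (Rat.cast : ℚ → ℝ)
/-- The factor's state block over `ℝ`. -/
def G1r : Matrix (Fin 10 ⊕ Fin 9) (Fin 19) ℝ := G1Tᵣ.map (Rat.cast : ℚ → ℝ)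
/-- The factor's channel block over `ℝ`. -/
def Hr : Matrix ((Fin 10 × Fin 10) ⊕ (Fin 10 × Fin 10)) (Fin 19) ℝ := HTᵣ.map (Rat.cast : ℚ → ℝ)
/-- The witness's lower slopes over `ℝ`. -/
def a0 (k : (Fin 10 × Fin 10) ⊕ (Fin 10 × Fin 10)) : ℝ := (a0Kᵣ k : ℝ)
/-- The witness's upper slopes over `ℝ`. -/
def b0 (k : (Fin 10 × Fin 10) ⊕ (Fin 10 × Fin 10)) : ℝ := (b0Kᵣ k : ℝ)
/-- The window `γ₀ = 2·arctan(3/200)` (≈ 1.719°). -/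
def γ₀ : ℝ := 2 * Real.arctan ((u0Qᵣ : ℚ) : ℝ)

/-- `γ₀` is the literal window `2·arctan(3/200)` of the row's name. -/
theorem γ₀_eq : γ₀ = 2 * Real.arctan (3 / 200 : ℝ) := by
  unfold γ₀; norm_num [u0Qᵣ]

/-- `cos γ₀ = cg0Qᵣ` (cast form, feeds `hwin`). -/
private theorem cos_γ₀_cast : Real.cos γ₀ = ((cg0Qᵣ : ℚ) : ℝ) := by
  unfold γ₀ cg0Qᵣ
  rw [Lyapunov.StructurePreserving.cos_two_mul_arctan]
  push_cast
  ring

/-- `sin γ₀ = sg0Qᵣ` (cast form, feeds `hwin`). -/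
private theorem sin_γ₀_cast : Real.sin γ₀ = ((sg0Qᵣ : ℚ) : ℝ) := by
  unfold γ₀ sg0Qᵣ
  rw [Lyapunov.StructurePreserving.sin_two_mul_arctan]
  push_cast
  ring

-- the closed forms `cos(2·arctan(3/200)) = 39991/40009`, `sin = 1200/40009` are `NE39LossySplitLinesU3o200LPCert.cos_sin_γL`

/-- `0 ≤ γ₀ < π/2`. -/
private theorem γ₀_range : 0 ≤ γ₀ ∧ γ₀ < π / 2 := by
  have hu : (0 : ℝ) ≤ ((u0Qᵣ : ℚ) : ℝ) := by exact_mod_cast u0Q_pos_ltᵣ.1.le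
  have hu1 : ((u0Qᵣ : ℚ) : ℝ) < 1 := by exact_mod_cast u0Q_pos_ltᵣ.2
  exact ⟨Lyapunov.StructurePreserving.two_mul_arctan_nonneg hu,
    Lyapunov.StructurePreserving.two_mul_arctan_lt_pi_div_two hu1⟩

/-- `γ₀ ≤ 3 / 100` rad (`arctan u ≤ u`). -/
theorem γ₀_le : γ₀ ≤ 3 / 100 := by
  unfold γ₀
  have h : Real.arctan ((u0Qᵣ : ℚ) : ℝ) ≤ ((u0Qᵣ : ℚ) : ℝ) :=
    Lyapunov.StructurePreserving.arctan_le_self (by exact_mod_cast u0Q_pos_ltᵣ.1.le)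
  have : ((u0Qᵣ : ℚ) : ℝ) = 3 / 200 := by norm_num [u0Qᵣ]
  linarith

/-! ### `Z ⪰ 0` BY THE GRAM STRUCTURE, and (D1) over `ℝ` -/

/-- The receptacle's block matrix IS `[G1; H]·[G1; H]ᵀ` (plumbing). -/
private theorem fromBlocks_eq_gram :
    Matrix.fromBlocks Z₁₁ Z₂₁ᵀ Z₂₁ Z₂₂ = Matrix.fromRows G1r Hr * (Matrix.fromRows G1r Hr)ᴴ := by
  rw [Matrix.conjTranspose_eq_transpose_of_trivial, Matrix.transpose_fromRows, Matrix.fromRows_mul_fromCols,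
    Z₁₁, Z₂₁, Z₂₂, Z11Q_gramᵣ, Z21Q_gramᵣ, Z22Qᵣ, G1r, Hr, map_mul', map_mul', map_mul', map_transpose', map_transpose',
    Matrix.transpose_mul, Matrix.transpose_transpose]

/-- **`Z ⪰ 0`** — for free: a Gram matrix (feeds `D`). [cite: HornJohnson2013, Thm 7.2.7] -/
private theorem psd : (Matrix.fromBlocks Z₁₁ Z₂₁ᵀ Z₂₁ Z₂₂).PosSemidef := by
  rw [fromBlocks_eq_gram]
  exact Matrix.posSemidef_self_mul_conjTranspose _

/-- **The adjoint image is rational**: `W + Wᵀ = HQᵣ ↦ ℝ` (plumbing). -/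
private theorem adj_eq : dualAdjP NE39.splitLurieLinesSystem Z₁₁ Z₂₁ + (dualAdjP NE39.splitLurieLinesSystem Z₁₁ Z₂₁)ᵀ
    = HQᵣ.map (Rat.cast : ℚ → ℝ) := by
  have hX : dualAdjP NE39.splitLurieLinesSystem Z₁₁ Z₂₁ = XQᵣ.map (Rat.cast : ℚ → ℝ) := by
    rw [dualAdjP, A_eq, B_eq, Z₁₁, Z₂₁, XQᵣ, map_sub', map_add', map_mul', map_mul', map_transpose',
      map_smul', map_mul', Rat.cast_ofNat]
  rw [hX, HQᵣ, map_add', map_transpose']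

/-- **(D1)** `W + Wᵀ ⪰ 0` (feeds `D`). -/
private theorem adjP_psd :
    (dualAdjP NE39.splitLurieLinesSystem Z₁₁ Z₂₁ + (dualAdjP NE39.splitLurieLinesSystem Z₁₁ Z₂₁)ᵀ).PosSemidef := by
  rw [adj_eq, HQ_eqᵣ]
  exact (HD_ldlᵣ.posSemidef (R := ℝ)).submatrix e1

/-! ### (D2), (D3), (D4) and the null channels over `ℝ` -/

/-- The four dual functionals are the casts of `UQᵣ`, `VQᵣ`, `WQᵣ`, `SQᵣ` (`s_k` loses its `B`-part because `C·B = 0`). -/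
theorem functionals_eq (k : (Fin 10 × Fin 10) ⊕ (Fin 10 × Fin 10)) :
    (NE39.splitLurieLinesSystem.C * Z₁₁ * NE39.splitLurieLinesSystem.Cᵀ) k k = ((UQᵣ k : ℚ) : ℝ) ∧
    (Z₂₁ * NE39.splitLurieLinesSystem.Cᵀ) k k = ((VQᵣ k : ℚ) : ℝ) ∧
    Z₂₂ k k = ((WQᵣ k : ℚ) : ℝ) ∧
    dualPopovCoeff NE39.splitLurieLinesSystem Z₂₁ Z₂₂ k = ((SQᵣ k : ℚ) : ℝ) := by
  have hCB := C_mul_B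
  refine ⟨?_, ?_, ?_, ?_⟩
  · rw [C_eq, Z₁₁, ← map_transpose', ← map_mul', ← map_mul', Matrix.map_apply, UQᵣ]
  · rw [C_eq, Z₂₁, ← map_transpose', ← map_mul', Matrix.map_apply, VQᵣ]
  · rw [Z₂₂, Matrix.map_apply, WQᵣ]
  · rw [dualPopovCoeff, Matrix.mul_assoc, ← Matrix.mul_assoc NE39.splitLurieLinesSystem.C, hCB,
      Matrix.zero_mul, Matrix.zero_apply, sub_zero, C_eq, A_eq, Z₂₁, ← map_mul', ← map_transpose',
      ← map_mul', Matrix.map_apply, SQᵣ]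

/-- **(D2)** at the witness slopes (feeds `D`). -/
private theorem sectorCoeff_nonneg (k : (Fin 10 × Fin 10) ⊕ (Fin 10 × Fin 10)) :
    0 ≤ dualSectorCoeff NE39.splitLurieLinesSystem Z₁₁ Z₂₁ Z₂₂ a0 b0 k := by
  obtain ⟨hU, hV, hW, -⟩ := functionals_eq k
  rw [dualSectorCoeff, hU, hV, hW, a0, b0]
  exact_mod_cast (dual_testsᵣ k).1

/-- **(D3)** on the admissible channels: `a0_k ≥ 0 → s_k ≥ 0` (feeds `D`). -/
private theorem popovCoeff_nonneg (k : (Fin 10 × Fin 10) ⊕ (Fin 10 × Fin 10)) (hk : 0 ≤ a0 k) :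
    0 ≤ dualPopovCoeff NE39.splitLurieLinesSystem Z₂₁ Z₂₂ k := by
  rw [(functionals_eq k).2.2.2]
  have hk' : 0 ≤ a0Kᵣ k := by unfold a0 at hk; exact_mod_cast hk
  exact_mod_cast (dual_testsᵣ k).2.1 hk'

/-- **(D4a)** `a0 < b0` (feeds `D`). -/
private theorem slope_lt (k : (Fin 10 × Fin 10) ⊕ (Fin 10 × Fin 10)) : a0 k < b0 k := by
  unfold a0 b0; exact_mod_cast (dual_testsᵣ k).2.2.1

/-- **(D4b)** `tr Z₁₁ > 0` (feeds `D`). -/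
private theorem trace_pos : 0 < Matrix.trace Z₁₁ := by
  have h : Matrix.trace Z₁₁ = ((Matrix.trace Z11Qᵣ : ℚ) : ℝ) := by
    simp [Z₁₁, Matrix.trace, Rat.cast_sum]
  rw [h]; exact_mod_cast trace_testᵣ

/-- **THE CLASS-OF-RECORD DUAL WITNESS** against the slab/Popov certificate class `SlabCertificate` on `S = NE39.splitLurieLinesSystem` at the
window-extreme slopes `(a0, b0)` of the window `γ₀ = 2·arctan(3/200)` — rank 19, Gram-factored.
[cite: BoydVandenberghe2004, §5.9.4 (5.97)–(5.98), Example 5.14; Khalil2002, §7.1 Example 7.5] -/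
def D : SlabDualWitness NE39.splitLurieLinesSystem a0 b0 where
  Z₁₁ := Z₁₁
  Z₂₁ := Z₂₁
  Z₂₂ := Z₂₂
  psd := psd
  adjP_psd := adjP_psd
  sectorCoeff_nonneg := sectorCoeff_nonneg
  popovCoeff_nonneg := popovCoeff_nonneg
  slope_lt := slope_lt
  trace_pos := trace_pos

/-- The diagonal channels (both families) are NULL for the witness (four vanishing functionals). -/
private theorem isNull_diag (k : (Fin 10 × Fin 10) ⊕ (Fin 10 × Fin 10)) (hk : (pairOfᵣ k).1 = (pairOfᵣ k).2) : D.IsNull k := by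
  obtain ⟨hU, hV, hW, hS⟩ := functionals_eq k
  obtain ⟨h1, h2, h3, h4⟩ := (dual_testsᵣ k).2.2.2 hk
  refine ⟨?_, ?_, ?_, ?_⟩
  · show (NE39.splitLurieLinesSystem.C * Z₁₁ * NE39.splitLurieLinesSystem.Cᵀ) k k = 0; rw [hU]; exact_mod_cast h1
  · show (Z₂₁ * NE39.splitLurieLinesSystem.Cᵀ) k k = 0; rw [hV]; exact_mod_cast h2
  · show Z₂₂ k k = 0; rw [hW]; exact_mod_cast h3
  · show dualPopovCoeff NE39.splitLurieLinesSystem Z₂₁ Z₂₂ k = 0; rw [hS]; exact_mod_cast h4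

/-! ### The window points of the 180 channels `p ≠ q` (exact cosines; `ξ = 0` on the wide sine channels) -/

/-- The two window end points `δ ± γ` and their cosines from `(cos δ, sin δ) = (cδ, sδ)`, `(cos γ, sin γ) = (c, s)`. -/
private theorem window_points {δ γ cδ sδ c s : ℝ} (hc : Real.cos δ = cδ) (hs : Real.sin δ = sδ)
    (hcg : Real.cos γ = c) (hsg : Real.sin γ = s) (hγ : 0 ≤ γ) :
    (∃ ξ, |ξ - δ| ≤ γ ∧ Real.cos ξ = cδ * c - sδ * s) ∧ (∃ ξ, |ξ - δ| ≤ γ ∧ Real.cos ξ = cδ * c + sδ * s) :=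
  ⟨⟨δ + γ, by simp [abs_of_nonneg hγ], by rw [Real.cos_add, hc, hs, hcg, hsg]⟩,
    ⟨δ - γ, by simp [abs_of_nonneg hγ], by rw [Real.cos_sub, hc, hs, hcg, hsg]⟩⟩

/-- The centre `ξ = 0` lies in the window `|ξ − δ| ≤ γ` as soon as `cos γ ≤ cos δ` (`|δ| < π/2`, `0 ≤ γ < π/2`), and
`cos 0 = 1`. -/
private theorem center_point {δ γ cδ c : ℝ} (hδ : |δ| < π / 2) (hγ0 : 0 ≤ γ) (_hγ : γ < π / 2)
    (hc : Real.cos δ = cδ) (hcg : Real.cos γ = c) (hle : c ≤ cδ) :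
    ∃ ξ, |ξ - δ| ≤ γ ∧ Real.cos ξ = 1 := by
  refine ⟨0, ?_, Real.cos_zero⟩
  rw [zero_sub, abs_neg]
  by_contra hlt
  push Not at hlt
  have h1 : Real.cos |δ| < Real.cos γ :=
    Real.cos_lt_cos_of_nonneg_of_le_pi hγ0 (by linarith [abs_nonneg δ, Real.pi_pos]) hlt
  rw [Real.cos_abs, hc, hcg] at h1
  linarith

/-- **`hwin`**: every channel is NULL or has window points `ξa`, `ξb` in `|ξ − δ*_k| ≤ γ₀` with `cos ξa ≤ a0_k`,
`b0_k ≤ cos ξb`. -/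
private theorem hwin : ∀ k, D.IsNull k ∨
    ((∃ ξ, |ξ - NE39.splitLurieLinesSystem.δs k| ≤ γ₀ ∧ Real.cos ξ ≤ a0 k) ∧
      ∃ ξ, |ξ - NE39.splitLurieLinesSystem.δs k| ≤ γ₀ ∧ b0 k ≤ Real.cos ξ) := by
  rintro (⟨p, q⟩ | ⟨p, q⟩)
  · by_cases hpq : p = q
    · exact Or.inl (isNull_diag _ hpq)
    right
    have hδs : NE39.splitLurieLinesSystem.δs (Sum.inl (p, q)) = NE39.preLossless.angleOf p - NE39.preLossless.angleOf q := rfl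
    obtain ⟨⟨ξ₁, hξ₁, hc₁⟩, ξ₂, hξ₂, hc₂⟩ := window_points (NE39.cos_angleOf_sub p q)
      (NE39.sin_angleOf_sub p q) cos_γ₀_cast sin_γ₀_cast γ₀_range.1
    obtain ⟨hlo, hhi⟩ := window_tests_sinᵣ p q hpq
    rw [hδs]
    refine ⟨?_, ?_⟩
    · rcases hlo with h | h
      · exact ⟨ξ₁, hξ₁, by rw [hc₁, a0]; exact_mod_cast h⟩
      · exact ⟨ξ₂, hξ₂, by rw [hc₂, a0]; exact_mod_cast h⟩
    · rcases hhi with (h | h) | ⟨hw, hb⟩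
      · exact ⟨ξ₁, hξ₁, by rw [hc₁, b0]; exact_mod_cast h⟩
      · exact ⟨ξ₂, hξ₂, by rw [hc₂, b0]; exact_mod_cast h⟩
      · obtain ⟨ξ₀, hξ₀, hc₀⟩ := center_point (NE39.abs_angle_sub_lt p q) γ₀_range.1 γ₀_range.2
          (NE39.cos_angleOf_sub p q) cos_γ₀_cast (by exact_mod_cast hw)
        exact ⟨ξ₀, hξ₀, by rw [hc₀, b0]; exact_mod_cast hb⟩
  · by_cases hpq : p = q
    · exact Or.inl (isNull_diag _ hpq)
    right
    have hδs : NE39.splitLurieLinesSystem.δs (Sum.inr (p, q)) = NE39.preLossless.angleOf p - NE39.preLossless.angleOf q + π / 2 := rfl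
    have hc : Real.cos (NE39.preLossless.angleOf p - NE39.preLossless.angleOf q + π / 2) = -((NE39.preLossless.sd p q : ℚ) : ℝ) := by
      rw [Real.cos_add_pi_div_two, NE39.sin_angleOf_sub]
    have hs : Real.sin (NE39.preLossless.angleOf p - NE39.preLossless.angleOf q + π / 2) = ((NE39.preLossless.cd p q : ℚ) : ℝ) := by
      rw [Real.sin_add_pi_div_two, NE39.cos_angleOf_sub]
    obtain ⟨⟨ξ₁, hξ₁, hc₁⟩, ξ₂, hξ₂, hc₂⟩ := window_points hc hs cos_γ₀_cast sin_γ₀_cast γ₀_range.1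
    obtain ⟨hlo, hhi⟩ := window_tests_cosᵣ p q hpq
    rw [hδs]
    refine ⟨?_, ?_⟩
    · rcases hlo with h | h
      · exact ⟨ξ₁, hξ₁, by rw [hc₁, a0]; exact_mod_cast h⟩
      · exact ⟨ξ₂, hξ₂, by rw [hc₂, a0]; exact_mod_cast h⟩
    · rcases hhi with h | h
      · exact ⟨ξ₁, hξ₁, by rw [hc₁, b0]; exact_mod_cast h⟩
      · exact ⟨ξ₂, hξ₂, by rw [hc₂, b0]; exact_mod_cast h⟩

/-! ### THE THEOREMS -/

/-- **No certificate of the CLASS OF RECORD (`SlabCertificate S`: `P ⪰ ε·1`, Popov terms only where `a ≥ 0`) on the split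
presentation of the lossy 39-bus model at `γ₀`.** [cite: BoydVandenberghe2004, §5.9.4 (5.97)–(5.98), Example 5.14; Khalil2002, §7.1 Example 7.5] -/
theorem no_splitSlabCertificate_at (Λ : SlabCertificate NE39.splitLurieLinesSystem)
    (hsec : ∀ k ξ, |ξ - NE39.splitLurieLinesSystem.δs k| ≤ γ₀ → Λ.a k ≤ Real.cos ξ ∧ Real.cos ξ ≤ Λ.b k) :
    False :=
  Λ.false_of_dualWitness_of_exists_window D (γ := fun _ => γ₀) hsec hwin

/-- **Per-channel windows**: the refutation needs the window only on the 180 channels `p ≠ q` and only `γ_k ≥ γ₀` there. -/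
theorem no_splitSlabCertificate_perChannel (Λ : SlabCertificate NE39.splitLurieLinesSystem) (γ : (Fin 10 × Fin 10) ⊕ (Fin 10 × Fin 10) → ℝ)
    (hγ : ∀ k, (pairOfᵣ k).1 ≠ (pairOfᵣ k).2 → γ₀ ≤ γ k)
    (hsec : ∀ k ξ, |ξ - NE39.splitLurieLinesSystem.δs k| ≤ γ k → Λ.a k ≤ Real.cos ξ ∧ Real.cos ξ ≤ Λ.b k) :
    False := by
  refine Λ.false_of_dualWitness_of_exists_window D (γ := γ) hsec fun k => ?_
  by_cases hk : (pairOfᵣ k).1 = (pairOfᵣ k).2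
  · exact Or.inl (isNull_diag k hk)
  · rcases hwin k with h | ⟨⟨ξa, hξa, hca⟩, ξb, hξb, hcb⟩
    · exact Or.inl h
    · exact Or.inr ⟨⟨ξa, hξa.trans (hγ k hk), hca⟩, ξb, hξb.trans (hγ k hk), hcb⟩

/-- `γ₀ ≤ 2·arctan(3/200)`: this file's window is at most «NE39-LOSSY-SPLITU»'s second window. -/
theorem γ₀_le_γ3_200 : γ₀ ≤ 2 * Real.arctan (3 / 200 : ℝ) := by
  unfold γ₀
  have h : ((u0Qᵣ : ℚ) : ℝ) ≤ 3 / 200 := by norm_num [u0Qᵣ]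
  have := Real.arctan_strictMono.monotone h
  linarith

/-- **THE POSITIVITY LEVER MOVES THE 39-BUS SPLIT WINDOW**: at the window `2·arctan(3/200)` (≈ 1.719°) the Lur'e–Postnikov
POSITIVITY class on `S` is NON-EMPTY (`NE39LossySplitLinesU3o200LPCert.lpSplitClass_nonempty_NE39`, exact Schur-form
certificate) while the CLASS OF RECORD is EMPTY there and at every larger window (this file's rank-19 Gram-factored dual
witness at `γ₀ = 2·arctan(3/200) ≤ 2·arctan(3/200)`). -/
theorem positivityLever_split_NE39 :
    (∃ Λ : LPSlabCertificate NE39.splitLurieLinesSystem,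
      ∀ k ξ, |ξ - NE39.splitLurieLinesSystem.δs k| ≤ 2 * Real.arctan (3 / 200 : ℝ) → Λ.a k ≤ Real.cos ξ ∧ Real.cos ξ ≤ Λ.b k) ∧
    ∀ γ' : ℝ, 2 * Real.arctan (3 / 200 : ℝ) ≤ γ' → ¬ ∃ Λ : SlabCertificate NE39.splitLurieLinesSystem,
      ∀ k ξ, |ξ - NE39.splitLurieLinesSystem.δs k| ≤ γ' → Λ.a k ≤ Real.cos ξ ∧ Real.cos ξ ≤ Λ.b k :=
  ⟨NE39LossySplitLinesU3o200LPCert.lpSplitClass_nonempty_NE39,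
    fun _ hγ' ⟨Λ, hsec⟩ => no_splitSlabCertificate_at Λ fun k ξ hξ => hsec k ξ (hξ.trans (γ₀_le_γ3_200.trans hγ'))⟩

end Summit.Ventures.GridStability.Lyapunov.NE39LossySplitLinesRecDual

end
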